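import Literature.AlgebraicGeometry.HodgeTheory.BettiHodgeConjectureProductsHodgeDisjointWindow
import HarnessLib

/-!
# Hodge-disjoint windows, worked out for a curve or a surface as first factor: `HC(C × X)` ⟸ `HC(X)` and `h^{n+1−c, n−c}(X) = 0` (`2 ≤ c`, `2c ≤ n + 1`); `HC(S × X)` ⟸ `HC(X)`, the same vanishing
# (or `b₁(S) = 0`) and `Hdg¹(H²(S)) = H²(S;ℚ)` or `Hdg^{c−1}(H^{2c−2}(X)) = H^{2c−2}(X;ℚ)`; unconditionally **`HC(S × T)` for every surface `S` and threefold `T` with `h^{2,1}(T) = 0` (or `b₁(S) = 0`)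
# and `h^{2,0}(T) = 0` (or `p_g(S) = 0`)** (Voisin I §7.1.1, §11.3.3 Thm. 11.38–11.40, Lemma 11.41, pp. 285–287, Thm. 11.30; Deligne Hodge II 1.2.5, 2.1.13; Voisin II Prop. 9.20, proof of Prop. 10.26)

Family `hodge`, lane `lit-hodgefound` (Track 2 foundations library; Layers A1/A4), layer `Literature/AlgebraicGeometry/HodgeTheory`.  THEOREMS ONLY (no definition, no named fact, no instance;
D-0026 net debt `0`).  The seat's g31-#16 (`HC(Y)`, `HC(Z)` and a Hodge-disjoint reduced window ⇒ `HC(Y × Z)`) read for a first factor of dimension `1` or `2`.  A curve `C` contributes only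
`H¹(C)` to the window; the twisted structure `H¹(C)(r)` (`r = c − n`) has the two types `(n + 1 − c, n − c)`, `(n − c, n + 1 − c)`, so the piece `H¹(C) ⊗ H^{2c−1}(X)` of `H^{2c}(C × X)` is
Hodge-disjoint iff `H^{2n+1−2c}(X)^{n+1−c, n−c} = 0` (with its conjugate, Hodge symmetry) — §1.  A surface `S` contributes `H¹(S)` (as a curve does; void when `b₁(S) = 0`) and `H²(S)`; the piece
`H²(S) ⊗ H^{2c−2}(X)` is never Hodge-disjoint (both carry Hodge classes) but drops out of the REDUCED window when `H²(S;ℚ)` consists of Hodge classes (`p_g(S) = 0`, Lefschetz `(1,1)`) or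
`H^{2c−2}(X;ℚ)` does — §2.  For `X = T` a threefold (`HC(T)`, `HC(S)`: the tree's `hodgeConjectureFor_of_dim_le_three_holds`) the only degree is `c = 2`: `HC(S × T)` as soon as
`H³(T)^{2,1} = 0` (or `b₁(S) = 0`) and `H²(T;ℚ)` or `H²(S;ℚ)` consists of Hodge classes — e.g. `T` a rigid Calabi–Yau threefold or a Fano threefold with `h^{2,1} = 0`, `S` arbitrary — §3.

WHAT IS PROVED.
* §1 **`BettiUniverse.hodgeConjectureFor_curve_tensor_of_forall_piece_eq_bot`** — `HC(C × X)` from `HC(X)` and `H^{2n+1−2c}(X)^{n+1−c, n−c} = 0` for `2 ≤ c`, `2c ≤ n + 1`.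
* §2 **`BettiUniverse.hodgeConjectureFor_surface_tensor_of_forall_piece_eq_bot_of_forall_hodgeClasses_eq_top`** — `HC(S × X)` from `HC(X)`, [`b₁(S) = 0` or the vanishing of §1], and [`Hdg¹(H²(S)) = ⊤`
  or `Hdg^{b}(H^{2b}(X)) = ⊤` for `b + 1 = c`, `2 ≤ c`, `2c ≤ n + 2`].
* §3 **`BettiUniverse.hodgeConjectureFor_surface_tensor_threefold_of_piece_two_one_eq_bot`** — `HC(S × T)`, unconditionally, for [`b₁(S) = 0` or `H³(T)^{2,1} = 0`] and [`Hdg¹(H²(S)) = ⊤` or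
  `Hdg¹(H²(T)) = ⊤`].

THE PRINTS.  C. Voisin (2002) [VoisinHodgeI2002] §7.1.1; §7.3.1 Def. 7.22; §11.3.1 Thm. 11.30; §11.3.3 Thm. 11.38–11.40, Lemma 11.41 and pp. 285–287.  P. Deligne (1971) [DeligneHodgeII1971] 1.2.5, 2.1.13.
C. Voisin (2003) [VoisinHodgeII2003] §9.2.4 Prop. 9.20, §10.2.3 proof of Prop. 10.26.  P. Deligne (2000/2006) [Deligne2000] §1.

THE OBJECTS (all the tree's).  `BettiUniverse.hodge`, `HodgeStructure.piece`, `hodgeClasses`, `conjPieceEquiv`, `bettiCohomology`, `Module.finrank`, `HodgeConjectureFor`; the seat's g31-#16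
`BettiUniverse.hodgeConjectureFor_tensor_of_forall_reducedWindow_hodgeDisjoint`, g31-#1 `HodgeModel.hodgeStructure_piece_eq_bot_of_neg`, the tree's `hodgeConjectureFor_of_dim_le_three_holds`.

DEVIATIONS / SCOPE.  Complex orientations (through g31-#14/#16).  `h^{p,q} = 0` is stated as the vanishing of the Hodge piece of the tree's `BettiUniverse.hodge` structure; "`H²;ℚ` consists of Hodge
classes" as `hodgeClasses 1 = ⊤`.  No definitions.

## References
* [VoisinHodgeI2002] C. Voisin, *Hodge Theory and Complex Algebraic Geometry I* (2002) — §7.1.1; §7.3.1 Def. 7.22; §11.3.1 Thm. 11.30; §11.3.3 Thm. 11.38–11.40, Lemma 11.41, pp. 285–287.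
* [DeligneHodgeII1971] P. Deligne, *Théorie de Hodge II* (1971) — 1.2.5, 2.1.13.
* [VoisinHodgeII2003] C. Voisin, *Hodge Theory and Complex Algebraic Geometry II* (2003) — §9.2.4 Prop. 9.20; §10.2.3 proof of Prop. 10.26.
* [Deligne2000] P. Deligne, *The Hodge conjecture* (Clay problem description) — §1.

## Provenance
Lane `lit-hodgefound` (Hodge path, Track 2), prover seat `lit-hodgefound-p29` (generation 31), self-proposed row g31-#17 (Hodge-disjoint windows for a curve / a surface as first factor;
`HC(S × T)` for `h^{2,1}(T) = h^{2,0}(T) = 0`).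
-/

noncomputable section

open scoped TensorProduct
open CategoryTheory MonoidalCategory CartesianMonoidalCategory Module Finset
open Literature.AlgebraicTopology.SingularHomology
open Literature.Geometry.Kaehler

namespace Literature.AlgebraicGeometry.HodgeTheory

open Literature.AlgebraicGeometry.Motives
open Literature.AlgebraicGeometry.Motives.HodgeStructure

/-- Hodge symmetry of the vanishing of a piece: `V^{p,q} = 0 ⟹ V^{q,p} = 0` (complex conjugation `V^{q,p} ≃ V^{p,q}`, the tree's `conjPieceEquiv`). [cite: VoisinHodgeI2002, §7.1.1 Def. 7.4] -/
private theorem piece_eq_bot_symm {V : Type} [AddCommGroup V] [Module ℚ V] {w : ℤ} (H : HodgeStructure V w) {p q : ℤ} (h : H.piece p q = ⊥) : H.piece q p = ⊥ := by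
  rw [Submodule.eq_bot_iff]
  intro x hx
  have hmem : ((H.conjPieceEquiv q p ⟨x, hx⟩ : H.piece p q) : ℂ ⊗[ℚ] V) ∈ (⊥ : Submodule ℂ (ℂ ⊗[ℚ] V)) := h.le (H.conjPieceEquiv q p ⟨x, hx⟩).2
  rw [Submodule.mem_bot] at hmem
  have h0 : H.conjPieceEquiv q p ⟨x, hx⟩ = 0 := Subtype.ext hmem
  exact congrArg Subtype.val ((H.conjPieceEquiv q p).injective (h0.trans (map_zero _).symm))

/-- The pair (`Hᵃ(X)`, `H¹(Y)(r)`), `a + 2r = 1`, is Hodge-disjoint as soon as `Hᵃ(X)^{1−r, −r} = 0`: `H¹(Y)(r)` has only the types `(1 − r, −r)`, `(−r, 1 − r)` (no negative index in `H¹(Y)`), and the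
second is the conjugate of the first. [cite: VoisinHodgeI2002, §7.1.1 and §11.3.3 p. 286] [cite: DeligneHodgeII1971, 2.1.13] -/
private theorem hodge_one_hodgeDisjoint (hHD : exists_isReal_hodgeModel) {m n : ℕ} {Y X : SchemeOver ℂ} (hY : IsSmoothProjective m Y) (hX : IsSmoothProjective n X) {a : ℕ} {r P Q : ℤ}
    (ha : ((a : ℕ) : ℤ) + 2 * r = 1) (hP : P = 1 - r) (hQ : Q = -r) (h : (BettiUniverse.hodge hHD hX a).piece P Q = ⊥) (p : ℤ) :
    (BettiUniverse.hodge hHD hX a).piece p (((a : ℕ) : ℤ) - p) = ⊥ ∨ (BettiUniverse.hodge hHD hY 1).piece (p + r) (((a : ℕ) : ℤ) - p + r) = ⊥ := by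
  subst hP hQ
  by_cases h1 : p = 1 - r
  · subst h1
    left
    rw [show ((a : ℕ) : ℤ) - (1 - r) = -r by omega]
    exact h
  by_cases h0 : p = -r
  · subst h0
    left
    rw [show ((a : ℕ) : ℤ) - -r = 1 - r by omega]
    exact piece_eq_bot_symm _ h
  · right
    by_cases hneg : p + r < 0
    · exact HodgeModel.hodgeStructure_piece_eq_bot_of_neg hY (BettiUniverse.realHodgeModel hHD hY) (BettiUniverse.realHodgeModel_isHodgeSymmetric hHD hY) 1 (Or.inl hneg)
    · exact HodgeModel.hodgeStructure_piece_eq_bot_of_neg hY (BettiUniverse.realHodgeModel hHD hY) (BettiUniverse.realHodgeModel_isHodgeSymmetric hHD hY) 1 (Or.inr (by omega))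

variable {n d : ℕ} {C S T X : SchemeOver ℂ}

variable [HodgeTensorFacts.{0, 0}]

/-! ### §1 A curve as first factor -/

/-- **`HC(C × X)` for a smooth projective curve `C` and a smooth projective `n`-fold `X` with `HC(X)` whose Hodge numbers `h^{n+1−c, n−c}(X)` (degree `2n + 1 − 2c`) vanish for `2 ≤ c`, `2c ≤ n + 1`**:
the reduced window of `C × X` consists of the pieces `H¹(C) ⊗ H^{2c−1}(X)`, `3 ≤ 2c − 1 ≤ n`, and `Hom_HS(H^{2n+1−2c}(X), H¹(C)(c − n)) = 0` since `H¹(C)(c − n)` has only the types `(n+1−c, n−c)`,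
`(n−c, n+1−c)` (g31-#16).  The degree `a` and type `(P, Q)` are bound by `a + 2c = 2n + 1`, `P + c = n + 1`, `Q + c = n`. [cite: VoisinHodgeI2002, §7.1.1, §11.3.3 Thm. 11.38–11.40, Lemma 11.41 and pp. 285–287, §11.3.1 Thm. 11.30]
[cite: DeligneHodgeII1971, 1.2.5 and 2.1.13] [cite: VoisinHodgeII2003, §9.2.4 Prop. 9.20] [cite: Deligne2000, §1] -/
theorem BettiUniverse.hodgeConjectureFor_curve_tensor_of_forall_piece_eq_bot (hHD : exists_isReal_hodgeModel) (hC : IsSmoothProjective 1 C) (hX : IsSmoothProjective n X)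
    (hCX : IsSmoothProjective d (C ⊗ X)) (hHCX : HodgeConjectureFor n X)
    (h : ∀ (c a : ℕ) (P Q : ℤ), 2 ≤ c → 2 * c ≤ n + 1 → a + 2 * c = 2 * n + 1 → P + ((c : ℕ) : ℤ) = ((n : ℕ) : ℤ) + 1 → Q + ((c : ℕ) : ℤ) = ((n : ℕ) : ℤ) →
      (BettiUniverse.hodge hHD hX a).piece P Q = ⊥) :
    HodgeConjectureFor d (C ⊗ X) := by
  refine BettiUniverse.hodgeConjectureFor_tensor_of_forall_reducedWindow_hodgeDisjoint hHD hC hX hCX (hodgeConjectureFor_of_dim_le_three_holds (by norm_num) hC) hHCX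
    fun c i j a r hc hi him hj hjn hij haj hr _ _ _ _ p ↦ ?_
  obtain rfl : i = 1 := by omega
  exact hodge_one_hodgeDisjoint hHD hC hX (by omega) rfl rfl (h c a (1 - r) (-r) hc (by omega) (by omega) (by omega) (by omega)) p

/-! ### §2 A surface as first factor -/

/-- **`HC(S × X)` for a smooth projective surface `S` and a smooth projective `n`-fold `X` with `HC(X)`** such that, for every `2 ≤ c`: (`2c ≤ n + 1`) `b₁(S) = 0` or `H^{2n+1−2c}(X)^{n+1−c, n−c} = 0`, and
(`2c ≤ n + 2`, `b + 1 = c`) `H²(S;ℚ)` consists of Hodge classes or `H^{2b}(X;ℚ)` does: the reduced window of `S × X` has the pieces `H¹(S) ⊗ H^{2c−1}(X)` (void when `b₁(S) = 0`, Hodge-disjoint under the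
vanishing) and `H²(S) ⊗ H^{2c−2}(X)`, which drops out when a factor consists of Hodge classes (g31-#14/#16). [cite: VoisinHodgeI2002, §7.1.1, §11.3.3 Thm. 11.38–11.40, Lemma 11.41 and pp. 285–287, §11.3.1 Thm. 11.30]
[cite: DeligneHodgeII1971, 1.2.5 and 2.1.13] [cite: VoisinHodgeII2003, §9.2.4 Prop. 9.20] [cite: Deligne2000, §1] -/
theorem BettiUniverse.hodgeConjectureFor_surface_tensor_of_forall_piece_eq_bot_of_forall_hodgeClasses_eq_top (hHD : exists_isReal_hodgeModel) (hS : IsSmoothProjective 2 S) (hX : IsSmoothProjective n X)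
    (hSX : IsSmoothProjective d (S ⊗ X)) (hHCX : HodgeConjectureFor n X)
    (h1 : ∀ (c a : ℕ) (P Q : ℤ), 2 ≤ c → 2 * c ≤ n + 1 → a + 2 * c = 2 * n + 1 → P + ((c : ℕ) : ℤ) = ((n : ℕ) : ℤ) + 1 → Q + ((c : ℕ) : ℤ) = ((n : ℕ) : ℤ) →
      Module.finrank ℚ (bettiCohomology S 1) = 0 ∨ (BettiUniverse.hodge hHD hX a).piece P Q = ⊥)
    (h2 : ∀ c b : ℕ, 2 ≤ c → 2 * c ≤ n + 2 → b + 1 = c → (BettiUniverse.hodge hHD hS 2).hodgeClasses 1 = ⊤ ∨ (BettiUniverse.hodge hHD hX (2 * b)).hodgeClasses b = ⊤) :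
    HodgeConjectureFor d (S ⊗ X) := by
  refine BettiUniverse.hodgeConjectureFor_tensor_of_forall_reducedWindow_hodgeDisjoint hHD hS hX hSX (hodgeConjectureFor_of_dim_le_three_holds (by norm_num) hS) hHCX
    fun c i j a r hc hi him hj hjn hij haj hr hbS _ hnS hnX p ↦ ?_
  have hi2 : i ≤ 2 := him
  interval_cases i
  · -- the piece `H¹(S) ⊗ H^{2c−1}(X)`
    rcases h1 c a (1 - r) (-r) hc (by omega) (by omega) (by omega) (by omega) with h0 | h
    · exact absurd h0 hbS.ne'
    · exact hodge_one_hodgeDisjoint hHD hS hX (by omega) rfl rfl h p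
  · -- the piece `H²(S) ⊗ H^{2c−2}(X)` is not in the reduced window
    rcases h2 c (c - 1) hc (by omega) (by omega) with hS2 | hX2
    · exact (hnS 1 (by omega) hS2).elim
    · exact (hnX (c - 1) (by omega) hX2).elim

/-! ### §3 A surface times a threefold with `h^{2,1} = 0` and `h^{2,0} = 0` -/

/-- **`HC(S × T)`, unconditionally, for every smooth projective surface `S` and threefold `T` with [`b₁(S) = 0` or `H³(T)^{2,1} = 0`] and [`H²(S;ℚ)` or `H²(T;ℚ)` consisting of Hodge classes]** — e.g.
`T` a rigid Calabi–Yau threefold, or a Fano threefold with `h^{2,1} = 0`, and `S` arbitrary: the reduced window of `S × T` lives in degree `4` only (`c = 2`; for `c = 3` a piece would need `i ≥ 3`), with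
the pieces `H¹(S) ⊗ H³(T)` (Hodge-disjoint) and `H²(S) ⊗ H²(T)` (a pure factor); `HC(S)`, `HC(T)` are the tree's `hodgeConjectureFor_of_dim_le_three_holds`.  Compare the tree's
`BettiUniverse.hodgeConjectureFor_surface_tensor_threefold_of_hom` (hypotheses on the `Hom_HS` spaces) and `…_of_q_zero_of_h20_zero` (the case `b₁(S) = 0`, `h^{2,0}(T) = 0`); here the hypotheses are
on the Hodge pieces themselves. [cite: VoisinHodgeI2002, §7.1.1, §11.3.3 Thm. 11.38–11.40, Lemma 11.41 and pp. 285–287, §11.3.1 Thm. 11.30]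
[cite: VoisinHodgeII2003, §9.2.4 Prop. 9.20, §10.2.3 proof of Prop. 10.26] [cite: DeligneHodgeII1971, 1.2.5 and 2.1.13] [cite: Deligne2000, §1] -/
theorem BettiUniverse.hodgeConjectureFor_surface_tensor_threefold_of_piece_two_one_eq_bot (hHD : exists_isReal_hodgeModel) (hS : IsSmoothProjective 2 S) (hT : IsSmoothProjective 3 T)
    (hST : IsSmoothProjective d (S ⊗ T)) (h21 : Module.finrank ℚ (bettiCohomology S 1) = 0 ∨ (BettiUniverse.hodge hHD hT 3).piece 2 1 = ⊥)
    (hpure : (BettiUniverse.hodge hHD hS 2).hodgeClasses 1 = ⊤ ∨ (BettiUniverse.hodge hHD hT 2).hodgeClasses 1 = ⊤) : HodgeConjectureFor d (S ⊗ T) := by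
  refine BettiUniverse.hodgeConjectureFor_surface_tensor_of_forall_piece_eq_bot_of_forall_hodgeClasses_eq_top hHD hS hT hST (hodgeConjectureFor_of_dim_le_three_holds le_rfl hT)
    (fun c a P Q hc hc' ha hP hQ ↦ ?_) (fun c b hc hc' hb ↦ ?_)
  · obtain rfl : c = 2 := by omega
    obtain rfl : a = 3 := by omega
    obtain rfl : P = 2 := by omega
    obtain rfl : Q = 1 := by omega
    exact h21
  · obtain rfl : c = 2 := by omega
    obtain rfl : b = 1 := by omega
    exact hpure

end Literature.AlgebraicGeometry.HodgeTheory

end
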